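import Summits.Parity.GeneralizedHardyLittlewood.Theses.LiouvilleShiftedTables

/-!
# SketchIdeator5 — crux stmt-Parity-11314 `EH` (crux-ideate round 2, ideator 5, 2026-08-16)

NO idea card is filed by this seat (verdict `blocked`, see `IdeatorMemo5.md`): every lever examined
reduces to a statement `≥ EH`, to a conjecture-grade GEH fragment without an engine, or to an
obstruction-side finding.  This sheet only TYPES the one clean by-product of the hunt, so that a
barrier-audit refuter or a later ideator can pick it up without re-deriving it:

* `HeavyClassAntiConcentration θ` ("Conjecture H", memo §4): a set `H ⊆ [1, X]` of size
  `≤ X/(log X)^B` cannot have, summed over the primes `q ∈ (X^θ, 2X^θ]`, popular residue classes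
  carrying `> X/(log X)^A` elements in total.  For `θ < 1/2` it is a THEOREM (classes of two
  distinct primes meet `X/(qq') + O(1)` times in `[1, X]` whatever the classes — forced pair
  intersections — and the Cauchy–Schwarz/Fisher bound closes; memo §4(i)); for `θ > 1/2` two classes
  meet `0` or `1` times at the adversary's discretion and the same bound stops at `|H| ≫ X^{2-2θ}`
  (Fourier) / `X^{1-2θ/3}` (additive energy) / `X^{1/2}` (Szemerédi–Trotter).  This is
  `Literature.Barriers.Parity.LargeSieveLevelHalf` (`N + Q²`, `N = X`) transcribed into incidence
  combinatorics; it is the statement a moduli-inside dispersion with a supremum over residues would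
  need before its first Cauchy–Schwarz (row plants, TRIAGE-r1-1 §E4) — and memo §2(b) shows that even
  WITH it the dispersion cannot be revived (pruning kills Poisson in `m`).
* Nothing below implies, or is implied by, the crux
  `Summit.Parity.GeneralizedHardyLittlewood.Theses.LiouvilleShiftedTables.EH`; it is recorded as
  NEGATIVE knowledge about one technique class, not as a line.
-/

namespace Summit.Parity.GeneralizedHardyLittlewood.Cruxes.EH.SketchIdeator5

open scoped Classical

/-- The popular-class count of `H` modulo `q`: `max_{a mod q} #{h ∈ H : h ≡ a (mod q)}`
(for `q = 0` this is `0`, harmless: only primes `q` are summed below). -/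
noncomputable def maxClassCount (H : Finset ℕ) (q : ℕ) : ℕ :=
  (Finset.range q).sup fun a => (H.filter fun h => h % q = a).card

/-- **Conjecture H(θ)** (heavy-class anti-concentration at prime moduli `X^θ`; memo §4).
For every `A > 0` there is `B > 0` such that for all large `X` and every `H ⊆ [1, X]` with
`#H ≤ X/(log X)^B`:  `∑_{X^θ < q ≤ 2X^θ, q prime} max_a #(H ∩ (a mod q)) ≤ X/(log X)^A`.
Calibration: a union of `k` full classes of distinct primes has `#H ≍ k·X^{1-θ}` and left side
`≍ #H + π(2X^θ)`, so `B = A + 1` is forced and consistent; a random `H` of density `(log X)^{-B}`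
gives left side `≍ X (log X)^{-B-1}`.  THEOREM for `θ < 1/2` (memo §4(i), `B = 2A + 2` suffices);
OPEN for `1/2 < θ < 1`, where counting arguments give only `#H ≫ X^{max(2-2θ, 1-2θ/3, 1/2) - o(1)}`
for a violating `H`. -/
def HeavyClassAntiConcentration (θ : ℝ) : Prop :=
  ∀ A : ℝ, 0 < A → ∃ B : ℝ, 0 < B ∧ ∃ X₀ : ℝ, ∀ X : ℝ, X₀ ≤ X → ∀ H : Finset ℕ,
    H ⊆ Finset.Icc 1 ⌊X⌋₊ → (H.card : ℝ) ≤ X / Real.log X ^ B →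
      (∑ q ∈ (Finset.Ioc ⌊X ^ θ⌋₊ ⌊2 * X ^ θ⌋₊).filter Nat.Prime, (maxClassCount H q : ℝ))
        ≤ X / Real.log X ^ A

/-- The DEPTH form used in memo §2(c): for a residue map `a : ℕ → ℕ` on the primes
`q ∈ (X^θ, 2X^θ]`, `dep a X θ u = #{q : u ≡ a q (mod q)}`. -/
noncomputable def dep (a : ℕ → ℕ) (X θ : ℝ) (u : ℕ) : ℕ :=
  (((Finset.Ioc ⌊X ^ θ⌋₊ ⌊2 * X ^ θ⌋₊).filter Nat.Prime).filter fun q => u % q = a q % q).card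

/-- **Deep-mass form** (memo §2(c)): for every residue map, the `(q,u)`-incidences at points of depth
`≥ (log X)^C` carry `≤ X/(log X)^A` mass once `C ≥ C(A, θ)`.  Implied by `HeavyClassAntiConcentration θ`
(take `H` = the deep points: `#H ≤ (4X/log X^θ)/(log X)^C` and each deep point is counted `dep` times,
once per prime whose chosen class contains it, so the deep mass is `≤ ∑_q max_a #(H ∩ a mod q)`). -/
def DeepMassSmall (θ : ℝ) : Prop :=
  ∀ A : ℝ, 0 < A → ∃ C : ℝ, 0 < C ∧ ∃ X₀ : ℝ, ∀ X : ℝ, X₀ ≤ X → ∀ a : ℕ → ℕ,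
    (∑ u ∈ (Finset.Icc 1 ⌊X⌋₊).filter (fun u => Real.log X ^ C ≤ (dep a X θ u : ℝ)),
        (dep a X θ u : ℝ)) ≤ X / Real.log X ^ A

/-- Sanity anchor: the sheet sees the crux BY NAME (it is not used). -/
example : Summit.Parity.GeneralizedHardyLittlewood.Theses.LiouvilleShiftedTables.EH ↔
    Literature.NumberTheory.Sieve.LevelOfDistribution.ElliottHalberstam := Iff.rfl

end Summit.Parity.GeneralizedHardyLittlewood.Cruxes.EH.SketchIdeator5
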